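import Literature.AlgebraicGeometry.AbelianSchemes.AbelianSchemeCotangentCharpoly   -- ★ p844516 ED. 2 (A-p01 (g22) D2b): `cotangentCharpoly`, `lieCharpoly`, `lieCharpoly_eq_of_iso`
import Literature.AlgebraicGeometry.AbelianSchemes.AbelianSchemeBaseChangeComp      -- ★ `AbelianSchemeOver.baseChangeCompGrpIso` (+ `_hom_hom_hom`, `unitSection_comp_…_hom_left`, `…_hom_left_inv_left`)
import HarnessLib

/-!
# `lieCharpoly` along a composite of base changes: `(A ×_S S') ×_{S'} Spec R' ≅ A ×_S Spec R'` gives the SAME characteristic polynomial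
# — the transport lemma under `kottwitz_baseChange` in the «local points» typing (Görtz–Wedhorn I (4.7), II Rem. 17.14; Kottwitz 1992 §5)

Topic `Literature/AlgebraicGeometry/AbelianSchemes`; namespace `Literature.AlgebraicGeometry.AbelianSchemes.AbelianSchemeOver`.  THEOREMS ONLY (no definition, no instance,
no notation, no named fact, no `sorry`).  Cell `pub/hodgecm-mathlib` (D-0151), programme P6 «MOD», ROW 3 organ L3.1∕L3.2, brick **(D2d)** of A-p01 (g22) (13:15:20Z proposal (β′)):
for `A : AbelianSchemeOver S`, `g : S' ⟶ S`, a LOCAL point `x' : Spec R' ⟶ S'` and an endomorphism `v` of `A` fixing the unit (e.g. a homomorphism), the chart-free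
`lieCharpoly` of the two `R'`-models `((A.baseChange g).baseChange x').toAffine` and `(A.baseChange (x' ≫ g)).toAffine` with the transported endomorphisms AGREE — by ★ D2b ED. 2
`lieCharpoly_eq_of_iso` applied to the GROUP isomorphism ★ `baseChangeCompGrpIso` (Mathlib `Over.pullbackComp`, natural in `A.X`).  Hence a Kottwitz condition typed as
«for every local point `x` of the base, `lieCharpoly (x^*A) (x^*ι a) = …`» is stable under base change `g : S' ⟶ S` in one line: the local point `x'` of `S'` is the local point
`x' ≫ g` of `S`.  Kit author A-p07 (g17).  HONEST LABEL: HC_CM is proved only modulo the cell's 2 remaining named inputs (hLiu418 24832, h413 24833) until rung 0 closes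
(`--supports stmt-HodgeConjecture-24832`).

## References
* [GortzWedhorn2020] U. Görtz, T. Wedhorn, *Algebraic Geometry I*, 2nd ed. (2020): Section (4.7) (transitivity of base change), Remark 16.54.
* [GortzWedhorn2023] U. Görtz, T. Wedhorn, *Algebraic Geometry II* (2023): Remark 17.14, (17.3).
* [Kottwitz1992] R. E. Kottwitz, JAMS 5 (1992): §5 p. 390 (the determinant condition depends only on the isomorphism class of `(A, i)`).
-/

set_option autoImplicit false

noncomputable section

open CategoryTheory CategoryTheory.Limits AlgebraicGeometry Polynomial MonObj

universe u

namespace Literature.AlgebraicGeometry.AbelianSchemes.AbelianSchemeOver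

variable {S S' T : Scheme.{u}} (A : AbelianSchemeOver S) (g : S' ⟶ S) (f' : T ⟶ S')

/-! ## §1 Plumbing around ★ `baseChangeCompGrpIso` (any `f' : T ⟶ S'`) -/

/-- `hom ≫ inv = 𝟙` for ★ `baseChangeCompGrpIso`, as `Over T`-morphisms of the carriers. [cite: GortzWedhorn2020, Section (4.7)] -/
theorem baseChangeCompGrpIso_hom_inv_over :
    (A.baseChangeCompGrpIso g f').hom.hom.hom ≫ (A.baseChangeCompGrpIso g f').inv.hom.hom = 𝟙 _ := by
  change ((A.baseChangeCompGrpIso g f').hom ≫ (A.baseChangeCompGrpIso g f').inv).hom.hom = _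
  rw [Iso.hom_inv_id]
  rfl

/-- `inv ≫ hom = 𝟙` for ★ `baseChangeCompGrpIso`, as `Over T`-morphisms of the carriers. [cite: GortzWedhorn2020, Section (4.7)] -/
theorem baseChangeCompGrpIso_inv_hom_over :
    (A.baseChangeCompGrpIso g f').inv.hom.hom ≫ (A.baseChangeCompGrpIso g f').hom.hom.hom = 𝟙 _ := by
  change ((A.baseChangeCompGrpIso g f').inv ≫ (A.baseChangeCompGrpIso g f').hom).hom.hom = _
  rw [Iso.inv_hom_id]
  rfl

/-- The inverse of ★ `baseChangeCompGrpIso` also carries the unit section to the unit section (companion of ★ `unitSection_comp_baseChangeCompGrpIso_hom_left`).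
[cite: GortzWedhorn2020, Remark 16.54] -/
theorem unitSection_comp_baseChangeCompGrpIso_inv_left :
    ((A.baseChange g).baseChange f').unitSection ≫ (A.baseChangeCompGrpIso g f').inv.hom.hom.left = (A.baseChange (f' ≫ g)).unitSection := by
  change (η[((A.baseChange g).baseChange f').X]).left ≫ _ = (η[(A.baseChange (f' ≫ g)).X]).left
  rw [← Over.comp_left, IsMonHom.one_hom]

/-- **NATURALITY**: the two transports `v ×_S T` and `(v ×_S S') ×_{S'} T` of an `S`-endomorphism `v` of the carrier correspond under ★ `baseChangeCompGrpIso`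
(Mathlib `Over.pullbackComp` is a natural isomorphism; ★ `baseChangeCompGrpIso_hom_hom_hom`). [cite: GortzWedhorn2020, Section (4.7)] -/
theorem pullback_map_comp_baseChangeCompGrpIso_hom (v : A.X ⟶ A.X) :
    (Over.pullback (f' ≫ g)).map v ≫ (A.baseChangeCompGrpIso g f').hom.hom.hom =
      (A.baseChangeCompGrpIso g f').hom.hom.hom ≫ (Over.pullback f').map ((Over.pullback g).map v) := by
  rw [baseChangeCompGrpIso_hom_hom_hom]
  exact (Over.pullbackComp f' g).hom.naturality v

/-! ## §2 The transport lemma over a local point -/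

/-- **`lieCharpoly` IS THE SAME FOR `(A ×_S S') ×_{S'} Spec R'` AND `A ×_S Spec R'`** with the transported endomorphisms (`R'` local, `A` of relative dimension `n`;
`v` an `S`-endomorphism of the carrier whose two transports fix the unit sections — for a HOMOMORPHISM `v` both hypotheses are ★ `AbelianSchemeOver.unitSection_comp_baseChangeHom_left`):
the transport lemma that makes a Kottwitz condition typed on LOCAL POINTS of the base stable under base change (the local point `x'` of `S'` IS the local point `x' ≫ g` of `S`).
Proof: ★ D2b ED. 2 `AbelianScheme.lieCharpoly_eq_of_iso` at the group isomorphism ★ `baseChangeCompGrpIso` and §1. [cite: GortzWedhorn2020, Section (4.7)]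
[cite: GortzWedhorn2023, Remark 17.14] [cite: Kottwitz1992, §5 p. 390] -/
theorem lieCharpoly_baseChange_comp_eq {R' : Type u} [CommRing R'] [IsLocalRing R'] (x' : Spec (.of R') ⟶ S') {n : ℕ} (hA : A.IsOfRelDim n) (v : A.X ⟶ A.X)
    (hev₁ : η[(A.baseChange (x' ≫ g)).X].left ≫ ((Over.pullback (x' ≫ g)).map v).left = η[(A.baseChange (x' ≫ g)).X].left)
    (hev₂ : η[((A.baseChange g).baseChange x').X].left ≫ ((Over.pullback x').map ((Over.pullback g).map v)).left = η[((A.baseChange g).baseChange x').X].left) :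
    (A.baseChange (x' ≫ g)).toAffine.lieCharpoly ((AbelianSchemeOver.isOfRelDim_toAffine_iff _ n).2 (hA.baseChange (x' ≫ g)))
        ((Over.pullback (x' ≫ g)).map v) hev₁ =
      ((A.baseChange g).baseChange x').toAffine.lieCharpoly ((AbelianSchemeOver.isOfRelDim_toAffine_iff _ n).2 ((hA.baseChange g).baseChange x'))
        ((Over.pullback x').map ((Over.pullback g).map v)) hev₂ :=
  -- all arguments explicit: with `_` holes the unifier times out on the `toAffine`/`Over.pullback` carriers
  AbelianScheme.lieCharpoly_eq_of_iso (A.baseChange (x' ≫ g)).toAffine ((A.baseChange g).baseChange x').toAffine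
    ((AbelianSchemeOver.isOfRelDim_toAffine_iff _ n).2 (hA.baseChange (x' ≫ g)))
    ((AbelianSchemeOver.isOfRelDim_toAffine_iff _ n).2 ((hA.baseChange g).baseChange x'))
    (A.baseChangeCompGrpIso g x').hom.hom.hom (A.baseChangeCompGrpIso g x').inv.hom.hom
    (A.baseChangeCompGrpIso_hom_inv_over g x') (A.baseChangeCompGrpIso_inv_hom_over g x')
    (A.unitSection_comp_baseChangeCompGrpIso_hom_left g x') (A.unitSection_comp_baseChangeCompGrpIso_inv_left g x')
    ((Over.pullback (x' ≫ g)).map v) hev₁ ((Over.pullback x').map ((Over.pullback g).map v)) hev₂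
    (A.pullback_map_comp_baseChangeCompGrpIso_hom g x' v)

end Literature.AlgebraicGeometry.AbelianSchemes.AbelianSchemeOver

end
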